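import Summits.HubbardSuperconductivity.HubbardSuperconductivity.Theorems.JosephsonMirrorJmCuspDedoubleTools
import Summits.HubbardSuperconductivity.HubbardSuperconductivity.Theorems.JosephsonMirrorJmCuspGainAbstract
import Summits.HubbardSuperconductivity.HubbardSuperconductivity.Theorems.JosephsonMirrorJmCuspSectorGap
import Literature.MathematicalPhysics.QuantumLattice.HubbardOneParticleCost

/-!
# Route `JosephsonMirror`, crux `JmCusp` (stmt-HubbardSuperconductivity-2228), line `Sketch`:
# the de-doubling inequality (`stub_dedouble`)

`ZeroModeCusp U δ a' g₀ → JosephsonGain U δ (a'²/(2(a'+32))) g₀` (both clauses written out; they are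
the `def`s of the lead skeleton `Cruxes/JmCusp/Lines/Sketch.lean`, `JosephsonGain U δ a J₀` being clause
(i) of the route decl `JmCusp` verbatim): a linear cusp of the single-layer, number-conserving
zero-mode d-wave deformation `H − (g/L²) Δ_d Δ_dᴴ` of `H = hubbardTorus 2 L 1 U` in the sector
`(N_L − 2, S^z = 0)` gives uniform linear Josephson gain of the window double.

Proof (all finite-dimensional): let `φ` be a unit ground state of the deformed layer in
`V₂ = szSector (N−2) 0` (eigenvalue `λ`; `stub_deformedGroundState`), `G = e₂ − λ ≥ a' g L²`
the hypothesis, `m = ‖Δᴴφ‖²`; the variational principle `e₂ ≤ ⟨φ,Hφ⟩ = λ + (g/L²) m` gives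
`m ≥ a' L⁴`. Feed the window double the trial pair `u = Δᴴφ/√m ∈ V₁`, `w = φ ∈ V₂`
(`stub_gainAbstract`): `E(0) − E(J) ≥ J m/L² − ε₁ − ε₂` with
`ε₂ = ⟨φ,Hφ⟩ − e₂ ≤ g m/L²` and, by the eigen-equation, `‖Δ‖² ≤ 32 L⁴` (`norm_pairField_dWave_sq_le`),
the single-commutator bound `‖[H, Δᴴ]‖ ≤ K L²`
(`norm_commutator_hubbardTorus_pairField_conjTranspose_le`) and `e₂ − e₁ ≤ C`
(`stub_sectorGap`), `ε₁ = ⟨u,Hu⟩ − e₁ ≤ C + 32 g L² + K/√a'`; with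
`g = J a'/(2(a'+32))` this is `≥ (a'/2) J L² − C' ≥ a'²/(2(a'+32)) · J L²` for `L ≥ L₀(J)`.

Sources: crux card `Cruxes/JmCusp/Ideas/dedouble-zero-mode-cusp.md`; T. Koma, H. Tasaki, J. Stat.
Phys. 76 (1994) 745 (two-sided variational bounds); E. H. Lieb, PRL 62 (1989) 1201 (the `W`-matrix
double). No new definitions.
-/

-- the mandated namespace `Summit.<Summit>.<Problem>.Theorems` repeats `HubbardSuperconductivity`
-- (single-problem summit, D-0017), which the `dupNamespace` linter flags on every declaration
set_option linter.dupNamespace false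

namespace Summit.HubbardSuperconductivity.HubbardSuperconductivity.Theorems.JosephsonMirror

open Matrix Literature.MathematicalPhysics.QuantumLattice Literature.Probability.LatticeModels
open Literature.MathematicalPhysics.QuantumLattice.ThermodynamicLimit
open scoped Kronecker ComplexOrder Matrix.Norms.L2Operator

/-- **Stub `stub_dedouble`** (line `Sketch`, crux `JmCusp`; registered signature, `def`s unfolded) — **the
de-doubling inequality**: the
single-layer zero-mode cusp `ZeroModeCusp U δ a' g₀` (for every `g ∈ (0, g₀]`, eventually in even
`L`, deforming `hubbardTorus 2 L 1 U` by `−(g/L²) Δ_d Δ_dᴴ` lowers the `(N_L − 2, S^z = 0)` floor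
by at least `a' g L²`) implies clause (i) of `JmCusp` with constant `a'²/(2(a'+32))` on `(0, g₀]`
(uniform linear Josephson gain of the window double). Trial pair `(Δᴴφ_g/‖Δᴴφ_g‖, φ_g)` at
`g = J a'/(2(a'+32))` in `stub_gainAbstract`; the errors are controlled by
`‖Δ_d‖ ≤ 4√2 L²`, `‖[H, Δ_d]‖ ≤ K L²` and `e_{N−2} − e_N ≤ C`. Koma–Tasaki, J. Stat. Phys. 76
(1994) 745; Lieb, PRL 62 (1989) 1201. [folklore] -/
theorem stub_dedouble (U δ a' g₀ : ℝ) (hδ : δ ∈ Set.Ioo (0:ℝ) (1 / 2)) (ha : 0 < a') :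
    (∀ g ∈ Set.Ioc (0:ℝ) g₀, ∃ L₀ : ℕ, ∀ (L : ℕ) [NeZero L], Even L → L₀ ≤ L → (let ι : Type := Finset (Literature.MathematicalPhysics.QuantumLattice.Orb (Literature.MathematicalPhysics.QuantumLattice.FermionTorus 2 L)); let N : ℕ := 2 * ⌊(1 - δ) * (L : ℝ) ^ 2 / 2⌋₊; let H : Matrix ι ι ℂ := Literature.MathematicalPhysics.QuantumLattice.hubbardTorus 2 L 1 U; let P : Matrix ι ι ℂ := Literature.MathematicalPhysics.QuantumLattice.pairField Literature.MathematicalPhysics.QuantumLattice.dWaveFormFactor L; a' * g * (L : ℝ) ^ 2 ≤ H.minEnergyOn (Literature.MathematicalPhysics.QuantumLattice.szSector (N - 2) 0) - (H - ((g / (L : ℝ) ^ 2 : ℝ) : ℂ) • (P * Pᴴ)).minEnergyOn (Literature.MathematicalPhysics.QuantumLattice.szSector (N - 2) 0))) →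
    ∀ J ∈ Set.Ioc (0:ℝ) g₀, ∃ L₀ : ℕ, ∀ (L : ℕ) [NeZero L], Even L → L₀ ≤ L → (let ι : Type := Finset (Literature.MathematicalPhysics.QuantumLattice.Orb (Literature.MathematicalPhysics.QuantumLattice.FermionTorus 2 L)); let N : ℕ := 2 * ⌊(1 - δ) * (L : ℝ) ^ 2 / 2⌋₊; let H : Matrix ι ι ℂ := Literature.MathematicalPhysics.QuantumLattice.hubbardTorus 2 L 1 U; let μ : ℝ := (H.minEnergyOn (Literature.MathematicalPhysics.QuantumLattice.szSector N 0) - H.minEnergyOn (Literature.MathematicalPhysics.QuantumLattice.szSector (N - 2) 0)) / 2; let A : Matrix ι ι ℂ := Literature.MathematicalPhysics.QuantumLattice.hubbardTorusWith 2 L 1 U μ; let D : Matrix ι ι ℂ := ((L : ℂ))⁻¹ • Literature.MathematicalPhysics.QuantumLattice.pairField Literature.MathematicalPhysics.QuantumLattice.dWaveFormFactor L; let Hd : ℝ → Matrix (ι × ι) (ι × ι) ℂ := fun J => Matrix.kroneckerMap (fun a b : ℂ => a * b) A 1 + Matrix.kroneckerMap (fun a b : ℂ => a * b) 1 (Matrix.transpose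 A) - (J : ℂ) • (Matrix.kroneckerMap (fun a b : ℂ => a * b) D (Matrix.transpose (Matrix.conjTranspose D)) + Matrix.kroneckerMap (fun a b : ℂ => a * b) (Matrix.conjTranspose D) (Matrix.transpose D)); let good : ι × ι → Prop := fun p => ((p.1.card = N ∧ p.2.card = N) ∨ (p.1.card = N - 2 ∧ p.2.card = N - 2)) ∧ (p.1.filter (fun o => (ofLex o).2 = 0)).card = (p.1.filter (fun o => (ofLex o).2 = 1)).card ∧ (p.2.filter (fun o => (ofLex o).2 = 0)).card = (p.2.filter (fun o => (ofLex o).2 = 1)).card; let S : Submodule ℂ (ι × ι → ℂ) := ⨅ (p : ι × ι) (_ : ¬ good p), LinearMap.ker (LinearMap.proj (R := ℂ) (φ := fun _ : ι × ι => ℂ) p); let E : ℝ → ℝ := fun J => (Hd J).minEnergyOn S; a' ^ 2 / (2 * (a' + 32)) * J * (L : ℝ) ^ 2 ≤ E 0 - E J) := by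
  intro hZ J hJ
  obtain ⟨hJ0, hJg₀⟩ := hJ
  -- the deformation strength `g = J a'/(2(a'+32)) ∈ (0, g₀]`
  set g : ℝ := J * a' / (2 * (a' + 32)) with hgdef
  have ha32 : 0 < a' + 32 := by linarith
  have hg0 : 0 < g := by positivity
  have hgJ2 : g ≤ J / 2 := deform_strength_le_half hJ0.le ha
  have hgJ : g ≤ J := by linarith
  have hgle : g ≤ g₀ := by linarith
  have hkey : (J - g) * a' - 32 * g = J * a' / 2 := by
    rw [hgdef]; field_simp; ring
  obtain ⟨L₁, hL₁⟩ := hZ g ⟨hg0, hgle⟩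
  obtain ⟨C, L₂, hC⟩ := stub_sectorGap U δ hδ
  -- the commutator constant and the total `O(1)` error
  set Kc : ℝ := (∑ e ∈ insert (0 : Site 2) unitSteps, ‖((dWaveFormFactor e / Real.sqrt 2 : ℝ) : ℂ)‖) *
    (72 * (2 + |U|)) with hKc
  have hKc0 : 0 ≤ Kc := mul_nonneg (Finset.sum_nonneg fun _ _ => norm_nonneg _) (by positivity)
  have hsa : 0 < Real.sqrt a' := Real.sqrt_pos.2 ha
  set C' : ℝ := max C 0 + Kc / Real.sqrt a' with hC'
  have hC'0 : 0 ≤ C' := add_nonneg (le_max_right _ _) (div_nonneg hKc0 hsa.le)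
  -- the threshold
  obtain ⟨L₃, hL₃⟩ : ∃ L₃ : ℕ, C' * (a' + 32) / (16 * a' * J) ≤ (L₃ : ℝ) := exists_nat_ge _
  refine ⟨max (max L₁ L₂) (max L₃ 2), fun L _ hE hL => ?_⟩
  have hLL₁ : L₁ ≤ L := le_trans (le_max_left _ _) (le_trans (le_max_left _ _) hL)
  have hLL₂ : L₂ ≤ L := le_trans (le_max_right _ _) (le_trans (le_max_left _ _) hL)
  have hLL₃ : L₃ ≤ L := le_trans (le_max_left _ _) (le_trans (le_max_right _ _) hL)
  have hL2 : 2 ≤ L := le_trans (le_max_right _ _) (le_trans (le_max_right _ _) hL)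
  intro ι N H μ A D Hd good S E
  -- (A) the filling `N = 2n`, `1 ≤ n ≤ L²`
  set n : ℕ := ⌊(1 - δ) * (L : ℝ) ^ 2 / 2⌋₊ with hn
  have hNn : N = 2 * n := rfl
  have hL2r : (2 : ℝ) ≤ L := by exact_mod_cast hL2
  have hn1 : 1 ≤ n := by
    rw [hn]
    refine Nat.le_floor ?_
    rw [Nat.cast_one, le_div_iff₀ (by norm_num : (0 : ℝ) < 2)]
    have hδ2 : 1 / 2 ≤ 1 - δ := by linarith [hδ.2]
    nlinarith [hδ2, hL2r]
  have hnL : n ≤ L ^ 2 := by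
    rw [hn]
    refine Nat.floor_le_of_le ?_
    have hδ0 : 1 - δ ≤ 1 := by linarith [hδ.1]
    have hL0 : (0 : ℝ) ≤ (L : ℝ) ^ 2 := by positivity
    push_cast
    nlinarith
  have hn'L : n - 1 ≤ L ^ 2 := le_trans (Nat.sub_le n 1) hnL
  have hN2 : N - 2 = 2 * (n - 1) := by omega
  have hN2' : ((N - 2 : ℕ) : ℝ) = (N : ℝ) - 2 := by
    rw [Nat.cast_sub (by omega)]
    norm_num
  have hL0 : (0 : ℝ) < L := by linarith
  have hL20 : (0 : ℝ) < (L : ℝ) ^ 2 := by positivity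
  -- energies and the balancing chemical potential
  set e₁ : ℝ := H.minEnergyOn (szSector N 0) with he₁
  set e₂ : ℝ := H.minEnergyOn (szSector (N - 2) 0) with he₂
  have hμ : μ = (e₁ - e₂) / 2 := rfl
  set a : ℝ := e₁ - μ * N with hadef
  have ha₂ : a = e₂ - μ * ((N - 2 : ℕ) : ℝ) := by
    rw [hN2', hadef, hμ]
    ring
  have hAherm : A.IsHermitian := isHermitian_hamiltonianWith _ 1 U μ
  -- block predicates and the window
  set F : ι → Prop := fun s =>
    (s.filter fun o => (ofLex o).2 = 0).card = (s.filter fun o => (ofLex o).2 = 1).card with hF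
  set P₁ : ι → Prop := fun s => s.card = N ∧ F s with hP₁
  set P₂ : ι → Prop := fun s => s.card = N - 2 ∧ F s with hP₂
  have h12 : ∀ s, P₁ s → ¬ P₂ s := by
    rintro s ⟨h1, -⟩ ⟨h2, -⟩
    omega
  have hgood : ∀ s t, good (s, t) → (P₁ s ∧ P₁ t) ∨ (P₂ s ∧ P₂ t) := by
    rintro s t ⟨h | h, hs, ht⟩
    · exact Or.inl ⟨⟨h.1, hs⟩, ⟨h.2, ht⟩⟩
    · exact Or.inr ⟨⟨h.1, hs⟩, ⟨h.2, ht⟩⟩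
  have hgood₁ : ∀ s t, P₁ s → P₁ t → good (s, t) := fun s t hs ht =>
    ⟨Or.inl ⟨hs.1, ht.1⟩, hs.2, ht.2⟩
  have hgood₂ : ∀ s t, P₂ s → P₂ t → good (s, t) := fun s t hs ht =>
    ⟨Or.inr ⟨hs.1, ht.1⟩, hs.2, ht.2⟩
  have hS : ∀ ψ, ψ ∈ S ↔ ∀ p, ¬ good p → ψ p = 0 := by
    intro ψ
    simp only [S, Submodule.mem_iInf, LinearMap.mem_ker, LinearMap.proj_apply]
  -- Rayleigh floors on the two blocks
  have hA₁ : ∀ v : ι → ℂ, (∀ s, ¬ P₁ s → v s = 0) →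
      a * (star v ⬝ᵥ v).re ≤ (star v ⬝ᵥ A *ᵥ v).re := by
    intro v hv
    have h := block_rayleigh_lower L U μ hnL v (by simpa [hP₁, hF, hNn] using hv)
    rw [hadef, hNn]
    exact h
  have hA₂ : ∀ v : ι → ℂ, (∀ s, ¬ P₂ s → v s = 0) →
      a * (star v ⬝ᵥ v).re ≤ (star v ⬝ᵥ A *ᵥ v).re := by
    intro v hv
    have h := block_rayleigh_lower L U μ hn'L v (by simpa [hP₂, hF, hN2] using hv)
    rw [← hN2] at h
    rw [ha₂]
    exact h
  -- (B) the deformed layer and its ground state in `V₂ = szSector (N - 2) 0`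
  set P : Matrix ι ι ℂ := pairField dWaveFormFactor L with hPdef
  set c : ℝ := g / (L : ℝ) ^ 2 with hcdef
  have hc0 : 0 < c := div_pos hg0 hL20
  set Hg : Matrix ι ι ℂ := H - (c : ℂ) • (P * Pᴴ) with hHg
  set lam : ℝ := Hg.minEnergyOn (szSector (N - 2) 0) with hlam
  -- the cusp hypothesis at this `L`
  have hZL : a' * g * (L : ℝ) ^ 2 ≤ e₂ - lam := hL₁ L hE hLL₁
  -- the ground state
  obtain ⟨φ, hφmem, hφ1, hHgφ⟩ :
      ∃ φ : Fock (Orb (FermionTorus 2 L)), φ ∈ szSector (N - 2) 0 ∧ star φ ⬝ᵥ φ = 1 ∧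
        Hg *ᵥ φ = ((lam : ℝ) : ℂ) • φ := by
    have h := stub_deformedGroundState (L := L) U c hn'L
    rw [← hN2] at h
    exact h
  -- sector facts for `φ`
  have hφsec : IsInSector (n - 1) (n - 1) φ :=
    (mem_szSector_two_mul_zero_iff (n - 1) φ).1 (hN2 ▸ hφmem)
  have hφP : ∀ s, ¬ P₂ s → φ s = 0 := fun s hs =>
    hφsec s fun h => hs (by simpa [hP₂, hF, hN2] using (block_iff (n - 1) s).2 h)
  have hφN : IsNParticle (N - 2) φ := ((mem_szSector_iff (N - 2) 0 φ).1 hφmem).1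
  -- the eigen-equation `H φ = λ φ + c Δ Δᴴ φ`
  have hHφ : H *ᵥ φ = ((lam : ℝ) : ℂ) • φ + (c : ℂ) • ((P * Pᴴ) *ᵥ φ) := by
    have h1 : Hg *ᵥ φ = H *ᵥ φ - (c : ℂ) • ((P * Pᴴ) *ᵥ φ) := by
      rw [hHg, sub_mulVec, smul_mulVec]
    rw [h1] at hHgφ
    exact sub_eq_iff_eq_add.1 hHgφ
  -- the pair amplitude `m = ‖Δᴴ φ‖²`
  set ξ : ι → ℂ := Pᴴ *ᵥ φ with hξ
  set m : ℝ := (star ξ ⬝ᵥ ξ).re with hmdef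
  have hm0 : 0 ≤ m := (Complex.nonneg_iff.mp (dotProduct_star_self_nonneg ξ)).1
  have hξξ : star ξ ⬝ᵥ ξ = (m : ℂ) := star_dotProduct_self_eq_re ξ
  clear_value m
  have hPξ : star φ ⬝ᵥ (P *ᵥ ξ) = (m : ℂ) := by
    rw [← hξξ, hξ, star_mulVec_dotProduct, conjTranspose_conjTranspose]
  have hφPPφ : star φ ⬝ᵥ ((P * Pᴴ) *ᵥ φ) = (m : ℂ) := by
    rw [← mulVec_mulVec]; exact hPξ
  -- `⟨φ, H φ⟩ = λ + c m`
  have hφHφ : star φ ⬝ᵥ (H *ᵥ φ) = ((lam + c * m : ℝ) : ℂ) := by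
    rw [hHφ, dotProduct_add, dotProduct_smul, dotProduct_smul, hφ1, hφPPφ, smul_eq_mul, smul_eq_mul]
    push_cast
    ring
  -- variational principle in `V₂`: `e₂ ≤ λ + c m`, hence `m ≥ a' L⁴ > 0`
  have he₂le : e₂ ≤ lam + c * m := by
    have hcard' : n - 1 ≤ Fintype.card (FermionTorus 2 L) := by rwa [card_fermionTorus]
    have h := (szSector_groundState (fermionTorusGraph 2 L) 1 U hcard').2 φ hφsec
    rw [← hN2, hφ1, Complex.one_re, mul_one] at h
    change e₂ ≤ (star φ ⬝ᵥ (H *ᵥ φ)).re at h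
    rwa [hφHφ, Complex.ofReal_re] at h
  have hcm : a' * g * (L : ℝ) ^ 2 ≤ c * m := by linarith
  have hmL : a' * (L : ℝ) ^ 4 ≤ m := by
    have h1 : g * (a' * (L : ℝ) ^ 4) ≤ g * m := by
      have h2 := mul_le_mul_of_nonneg_right hcm hL20.le
      have h3 : c * m * (L : ℝ) ^ 2 = g * m := by
        rw [hcdef]; field_simp
      calc g * (a' * (L : ℝ) ^ 4) = a' * g * (L : ℝ) ^ 2 * (L : ℝ) ^ 2 := by ring
        _ ≤ c * m * (L : ℝ) ^ 2 := h2
        _ = g * m := h3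
    exact le_of_mul_le_mul_left h1 hg0
  have hmpos : 0 < m := lt_of_lt_of_le (by positivity) hmL
  -- the trial pair: `u = Δᴴφ/√m ∈ V₁`, `w = φ ∈ V₂`
  set sm : ℝ := Real.sqrt m with hsm
  have hsm0 : 0 < sm := Real.sqrt_pos.2 hmpos
  have hsm2 : sm ^ 2 = m := Real.sq_sqrt hm0
  clear_value sm
  set u : ι → ℂ := ((sm⁻¹ : ℝ) : ℂ) • ξ with hu
  have hu1 : star u ⬝ᵥ u = 1 := by
    rw [hu, star_smul, smul_dotProduct, dotProduct_smul, smul_smul, hξξ, Complex.star_def,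
      Complex.conj_ofReal, smul_eq_mul, ← Complex.ofReal_mul, ← Complex.ofReal_mul]
    have h1 : sm⁻¹ * sm⁻¹ * m = 1 := by
      rw [← hsm2]; field_simp
    rw [h1, Complex.ofReal_one]
  have hξmem : ξ ∈ szSector N 0 := by
    have h := WcbcsSsbToTorusLRO.conjTranspose_pairFieldAt_mulVec_mem_szSector dWaveFormFactor
      (0 : TorusSite 2 L) hφmem
    rw [pairFieldAt_zero] at h
    have hN22 : N - 2 + 2 = N := by omega
    rw [hN22] at h
    exact h
  have humem : u ∈ szSector N 0 := Submodule.smul_mem _ _ hξmem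
  have husec : IsInSector n n u := (mem_szSector_two_mul_zero_iff n u).1 (hNn ▸ humem)
  have huP : ∀ s, ¬ P₁ s → u s = 0 := fun s hs =>
    husec s fun h => hs (by simpa [hP₁, hF, hNn] using (block_iff n s).2 h)
  have huN : IsNParticle N u := ((mem_szSector_iff N 0 u).1 humem).1
  -- (C) the abstract bound for the trial pair
  have key : J * ‖star φ ⬝ᵥ D *ᵥ u‖ ^ 2 - ((star u ⬝ᵥ A *ᵥ u).re - a) -
      ((star φ ⬝ᵥ A *ᵥ φ).re - a) ≤ E 0 - E J :=
    stub_gainAbstract A D hAherm P₁ P₂ h12 good hgood hgood₁ hgood₂ S hS a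
      hA₁ hA₂ u φ huP hφP hu1 hφ1 hJ0.le
  -- (D1) the gain term `‖⟨φ, D u⟩‖² = m / L²`
  have hDu : star φ ⬝ᵥ (D *ᵥ u) = ((((L : ℝ))⁻¹ * sm⁻¹ * m : ℝ) : ℂ) := by
    change star φ ⬝ᵥ ((((L : ℂ))⁻¹ • P) *ᵥ (((sm⁻¹ : ℝ) : ℂ) • ξ)) = _
    rw [smul_mulVec, mulVec_smul, dotProduct_smul, dotProduct_smul, hPξ, smul_eq_mul,
      smul_eq_mul]
    push_cast
    ring
  have hgain : ‖star φ ⬝ᵥ (D *ᵥ u)‖ ^ 2 = m / (L : ℝ) ^ 2 := by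
    rw [hDu, Complex.norm_real, Real.norm_eq_abs, sq_abs]
    have h1 : ((L : ℝ))⁻¹ * sm⁻¹ * m = sm / (L : ℝ) := by
      rw [← hsm2]; field_simp
    rw [h1, div_pow, hsm2]
  -- (D2) the `V₂` excitation: `Re⟨φ, A φ⟩ - a = λ + c m - e₂ ≤ c m`
  have hAφ : A *ᵥ φ = H *ᵥ φ - ((μ : ℂ) * ((N - 2 : ℕ) : ℂ)) • φ := by
    change hubbardTorusWith 2 L 1 U μ *ᵥ φ = _
    rw [hubbardTorusWith_eq, sub_mulVec, smul_mulVec, totalNumber_mulVec_of_isNParticle hφN,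
      smul_smul]
  have hw_est : (star φ ⬝ᵥ (A *ᵥ φ)).re - a ≤ c * m := by
    rw [hAφ, dotProduct_sub, dotProduct_smul, hφ1, hφHφ, Complex.sub_re, smul_eq_mul, mul_one,
      ← Complex.ofReal_natCast, ← Complex.ofReal_mul, Complex.ofReal_re, Complex.ofReal_re, ha₂]
    have h0 : 0 < a' * g * (L : ℝ) ^ 2 := by positivity
    linarith only [h0, hZL]
  -- (D3) the `V₁` excitation: `Re⟨u, A u⟩ - a = Re⟨u, H u⟩ - e₁ ≤ C + 32 g L² + K/√a'`
  have he₂e₁ : e₂ ≤ e₁ + C := hC L hLL₂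
  set Cm : Matrix ι ι ℂ := H * Pᴴ - Pᴴ * H with hCm
  have hCm_le : ‖Cm‖ ≤ Kc * (L : ℝ) ^ 2 :=
    norm_commutator_hubbardTorus_pairField_conjTranspose_le L U
  have hPsq : ‖P‖ ^ 2 ≤ 32 * (L : ℝ) ^ 4 := norm_pairField_dWave_sq_le L
  -- `H ξ = λ ξ + c Δᴴ η + [H, Δᴴ] φ` with `η = Δ Δᴴ φ = Δ ξ`
  set η : ι → ℂ := (P * Pᴴ) *ᵥ φ with hη
  have hηeq : η = P *ᵥ ξ := by rw [hη, hξ, mulVec_mulVec]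
  have hHξ : H *ᵥ ξ = ((lam : ℝ) : ℂ) • ξ + (c : ℂ) • (Pᴴ *ᵥ η) + Cm *ᵥ φ := by
    have h1 : H *ᵥ ξ = Pᴴ *ᵥ (H *ᵥ φ) + Cm *ᵥ φ := by
      rw [hCm, sub_mulVec, ← mulVec_mulVec, ← mulVec_mulVec, hξ]
      abel
    rw [h1, hHφ, mulVec_add, mulVec_smul, mulVec_smul]
  have hξHξ : star ξ ⬝ᵥ (H *ᵥ ξ) =
      ((lam : ℝ) : ℂ) * m + (c : ℂ) * (star η ⬝ᵥ η) + star ξ ⬝ᵥ (Cm *ᵥ φ) := by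
    have h2 := star_mulVec_dotProduct P ξ η
    rw [← hηeq] at h2
    rw [hHξ, dotProduct_add, dotProduct_add, dotProduct_smul, dotProduct_smul, hξξ, smul_eq_mul,
      smul_eq_mul, ← h2]
  -- Euclidean norms
  have hnφ : ‖(WithLp.toLp 2 φ : EuclideanSpace ℂ ι)‖ = 1 := by
    have h := norm_toLp_sq φ
    rw [hφ1, Complex.one_re] at h
    rwa [pow_eq_one_iff_of_nonneg (norm_nonneg _) two_ne_zero] at h
  have hnξ : ‖(WithLp.toLp 2 ξ : EuclideanSpace ℂ ι)‖ = sm := by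
    have h := norm_toLp_sq ξ
    rw [hξξ, Complex.ofReal_re] at h
    rw [← Real.sqrt_sq (norm_nonneg (WithLp.toLp 2 ξ : EuclideanSpace ℂ ι)), h, hsm]
  have hηη : (star η ⬝ᵥ η).re ≤ ‖P‖ ^ 2 * m := by
    rw [← norm_toLp_sq η, hηeq]
    have h := norm_toLp_mulVec_le P ξ
    rw [hnξ] at h
    calc ‖(WithLp.toLp 2 (P *ᵥ ξ) : EuclideanSpace ℂ ι)‖ ^ 2 ≤ (‖P‖ * sm) ^ 2 :=
          pow_le_pow_left₀ (norm_nonneg _) h 2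
      _ = ‖P‖ ^ 2 * m := by rw [mul_pow, hsm2]
  have hξCφ : (star ξ ⬝ᵥ (Cm *ᵥ φ)).re ≤ sm * (Kc * (L : ℝ) ^ 2) := by
    refine (Complex.re_le_norm _).trans ?_
    have h := norm_star_dotProduct_mulVec_le Cm ξ φ
    rw [hnξ, hnφ, mul_one] at h
    exact h.trans (mul_le_mul_of_nonneg_left hCm_le hsm0.le)
  -- `R = Re⟨ξ, H ξ⟩ ≤ λ m + c ‖Δ‖² m + √m K L²`
  set R : ℝ := (star ξ ⬝ᵥ (H *ᵥ ξ)).re with hR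
  clear_value R
  have hRle : R ≤ lam * m + c * (‖P‖ ^ 2 * m) + sm * (Kc * (L : ℝ) ^ 2) := by
    have h : R = lam * m + c * (star η ⬝ᵥ η).re + (star ξ ⬝ᵥ (Cm *ᵥ φ)).re := by
      rw [hR, hξHξ, Complex.add_re, Complex.add_re, ← Complex.ofReal_mul, Complex.ofReal_re,
        Complex.re_ofReal_mul]
    rw [h]
    exact add_le_add (add_le_add le_rfl (mul_le_mul_of_nonneg_left hηη hc0.le)) hξCφ
  -- `Re⟨u, A u⟩ - a = R/m - e₁`
  have hAu : A *ᵥ u = H *ᵥ u - ((μ : ℂ) * (N : ℂ)) • u := by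
    change hubbardTorusWith 2 L 1 U μ *ᵥ u = _
    rw [hubbardTorusWith_eq, sub_mulVec, smul_mulVec, totalNumber_mulVec_of_isNParticle huN,
      smul_smul]
  have huHu : (star u ⬝ᵥ (H *ᵥ u)).re = sm⁻¹ * sm⁻¹ * R := by
    rw [hu, mulVec_smul, star_smul, smul_dotProduct, dotProduct_smul, smul_smul, Complex.star_def,
      Complex.conj_ofReal, ← Complex.ofReal_mul, smul_eq_mul, Complex.re_ofReal_mul, hR]
  have hu_est' : (star u ⬝ᵥ (A *ᵥ u)).re - a = sm⁻¹ * sm⁻¹ * R - e₁ := by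
    rw [hAu, dotProduct_sub, dotProduct_smul, hu1, Complex.sub_re, smul_eq_mul, mul_one, huHu,
      ← Complex.ofReal_natCast, ← Complex.ofReal_mul, Complex.ofReal_re, hadef]
    ring
  -- the three pieces
  have hp1 : lam * m ≤ (e₁ + C) * m := by
    have h0 : 0 < a' * g * (L : ℝ) ^ 2 := by positivity
    have h1 : lam ≤ e₁ + C := by linarith only [h0, hZL, he₂e₁]
    exact mul_le_mul_of_nonneg_right h1 hm0
  have hp2 : c * (‖P‖ ^ 2 * m) ≤ 32 * g * (L : ℝ) ^ 2 * m := by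
    have h1 : c * ‖P‖ ^ 2 ≤ 32 * g * (L : ℝ) ^ 2 := by
      calc c * ‖P‖ ^ 2 ≤ c * (32 * (L : ℝ) ^ 4) := mul_le_mul_of_nonneg_left hPsq hc0.le
        _ = 32 * g * (L : ℝ) ^ 2 := by rw [hcdef]; field_simp
    have h2 := mul_le_mul_of_nonneg_right h1 hm0
    linarith only [h2]
  have hsmL : Real.sqrt a' * (L : ℝ) ^ 2 ≤ sm := by
    have h1 : Real.sqrt (a' * (L : ℝ) ^ 4) ≤ sm := by rw [hsm]; exact Real.sqrt_le_sqrt hmL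
    have h2 : Real.sqrt (a' * (L : ℝ) ^ 4) = Real.sqrt a' * (L : ℝ) ^ 2 := by
      rw [Real.sqrt_mul ha.le, show ((L : ℝ) ^ 4) = ((L : ℝ) ^ 2) ^ 2 by ring,
        Real.sqrt_sq hL20.le]
    rwa [h2] at h1
  clear_value Kc C'
  have hp3 : sm * (Kc * (L : ℝ) ^ 2) ≤ Kc / Real.sqrt a' * m := by
    rw [← hsm2, div_mul_eq_mul_div, le_div_iff₀ hsa]
    have h1 : Kc * (Real.sqrt a' * (L : ℝ) ^ 2) ≤ Kc * sm := mul_le_mul_of_nonneg_left hsmL hKc0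
    have h2 := mul_le_mul_of_nonneg_right h1 hsm0.le
    have h3 : sm * (Kc * (L : ℝ) ^ 2) * Real.sqrt a' = Kc * (Real.sqrt a' * (L : ℝ) ^ 2) * sm := by
      ring
    calc sm * (Kc * (L : ℝ) ^ 2) * Real.sqrt a' = Kc * (Real.sqrt a' * (L : ℝ) ^ 2) * sm := h3
      _ ≤ Kc * sm * sm := h2
      _ = Kc * sm ^ 2 := by ring
  have hu_est : (star u ⬝ᵥ (A *ᵥ u)).re - a ≤ C + 32 * g * (L : ℝ) ^ 2 + Kc / Real.sqrt a' := by
    rw [hu_est', sub_le_iff_le_add]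
    have hinv : sm⁻¹ * sm⁻¹ * R = m⁻¹ * R := by
      rw [← hsm2, ← mul_inv, ← sq]
    rw [hinv, inv_mul_le_iff₀ hmpos]
    linarith only [hRle, hp1, hp2, hp3]
  -- (E) assembly
  have hX : (J - g) * (a' * (L : ℝ) ^ 2) ≤ (J - g) * (m / (L : ℝ) ^ 2) := by
    refine mul_le_mul_of_nonneg_left ?_ (sub_nonneg.2 hgJ)
    rw [le_div_iff₀ hL20]
    calc a' * (L : ℝ) ^ 2 * (L : ℝ) ^ 2 = a' * (L : ℝ) ^ 4 := by ring
      _ ≤ m := hmL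
  have hcm_eq : c * m = g * (m / (L : ℝ) ^ 2) := by rw [hcdef]; ring
  have hC'ge : C + Kc / Real.sqrt a' ≤ C' := by
    rw [hC']; linarith only [le_max_left C 0]
  have hthr : C' ≤ 16 * a' / (a' + 32) * J * (L : ℝ) ^ 2 := by
    have hL1 : (1 : ℝ) ≤ L := by linarith
    have hLL : (L₃ : ℝ) ≤ (L : ℝ) ^ 2 := by
      calc (L₃ : ℝ) ≤ L := by exact_mod_cast hLL₃
        _ ≤ (L : ℝ) ^ 2 := by nlinarith only [hL1]
    have h1 : C' * (a' + 32) / (16 * a' * J) ≤ (L : ℝ) ^ 2 := hL₃.trans hLL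
    rw [div_le_iff₀ (by positivity)] at h1
    rw [div_mul_eq_mul_div, div_mul_eq_mul_div, le_div_iff₀ ha32]
    linarith only [h1]
  have hfin : a' ^ 2 / (2 * (a' + 32)) * J * (L : ℝ) ^ 2 =
      J * a' / 2 * (L : ℝ) ^ 2 - 16 * a' / (a' + 32) * J * (L : ℝ) ^ 2 := by
    field_simp
    ring
  rw [hgain] at key
  rw [hfin]
  have hkey2 : (J - g) * (a' * (L : ℝ) ^ 2) - 32 * g * (L : ℝ) ^ 2 = J * a' / 2 * (L : ℝ) ^ 2 := by
    rw [← hkey]; ring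
  linarith only [key, hX, hcm_eq, hC'ge, hthr, hkey2, hu_est, hw_est]

end Summit.HubbardSuperconductivity.HubbardSuperconductivity.Theorems.JosephsonMirror
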